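import Summits.CriticalPhenomena.PercolationContinuityZ3.Theorems.Transplant.SkelWinChainTA
import Summits.CriticalPhenomena.PercolationContinuityZ3.Theorems.Transplant.KNCells2ChainAdvR
import Summits.CriticalPhenomena.PercolationContinuityZ3.Theorems.Transplant.KNLevelsChainTransfer
import HarnessLib

/-!
# L6.0f — the ROOTED straight-run chain over a `PlanarSkeletonConc` as target steps in a window graph: the data `Skel.WinAdvData`
# (SkelWinChainTA) read with the rooted regions `Adv.regionR` (KNCells2ChainAdvR) — steps `stepAR`, regions `stepDR = Win root regionR_k Rπ`,
# the kits, the planar room and the transfer of the chain to a dominating event (the elongated deep route of a face-step contact);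
# generic twin of p2's `KNCellsBoxProdZ2ChainTAR`

builds on p205010 (kernel theorem, internal audit signed; external expert review pending) — nothing in this file uses p205010.
Status sentence (coordinator 2026-08-20T04:30Z): "θ(p_c) = 0 on ℤ^d, all d ≥ 2 — kernel-verified (Lean 4/Mathlib, standard axioms); internal adversarial
audit SIGNED 2026-08-20 04:29Z; external expert review pending."
Lane `prim-bschramm-*`, seat `prim-bschramm-stmt` (gen 7; port handed over by p2-g3 19:13:45Z); helper file (`--supports stmt-CriticalPhenomena-4575`).
* `WinAdvData.aregionR / stepDR / stepAR`; `enclR`, `coreT_subset_stepDR`, `coreER_subset_stepDR`, `stepDR_subset_prism`, **`kitsAt_stepAR`**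
  (true-target nonemptiness a hypothesis, as in `kitsAt_stepA`), **`roomR`** (planar, verbatim: `ℓ₁ ≥ 2q + s₁ + R'`), **`lt_real_of_advRChain`**
  (the chain of `nA + 1` rooted steps under any weighting of the window graph transferred to a dominating event: `1 - ε'' < μA`).
[cite: KozmaNitzan2024, §4 Lemma 10 (p. 17), Lemma 11 (pp. 22–23), Lemma 12 (pp. 23–25), p. 20 (Step IV)]
-/

noncomputable section

open MeasureTheory ProbabilityTheory
open scoped ENNReal

namespace Summit.CriticalPhenomena.PercolationContinuityZ3.Theorems

namespace Transplant

namespace Skel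

open Literature.Probability.Percolation Literature.Probability.LatticeModels SimpleGraph
open Literature.Probability.Percolation.KozmaNitzan
open Literature.Probability.Percolation.KozmaNitzan.Cells (sgOf sgOf_sign)
open KNLevels ChainPlanar

variable {V : Type} {G : SimpleGraph V} [G.LocallyFinite] (Φ : PlanarSkeletonConc G)

namespace WinAdvData

variable (P : WinAdvData V)

omit Φ in
/-- The rooted planar region `k`. [folklore] -/
def aregionR (k : ℕ) : Finset (Site 2) := Adv.regionR P.q P.s₁ P.ρ P.R' P.ax P.sg P.c k

/-- **The rooted region of step `k`**: `Win root regionR_k Rπ`. [cite: KozmaNitzan2024, §4 Lemma 10 (p. 17: D)] -/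
def stepDR (k : ℕ) : Finset V := Φ.Win P.root (P.aregionR k) P.Rπ

/-- **Step `k` of the rooted run as a target step** (same levels and enlarged target as `stepA`, rooted region). [cite: KozmaNitzan2024, §4 Lemma 11] -/
def stepAR [DecidableEq V] (k : ℕ) : TStep (winGraph G P.root P.Rπ) := ⟨P.stepL Φ k, P.stepDR Φ k, P.coreE Φ k, P.Rlev, P.N, P.j₀, P.j₁⟩

/-- The true targets link the rooted chain. [folklore] -/
theorem coreT_subset_XR_zero_succ [DecidableEq V] (hsg : P.sg = 1 ∨ P.sg = -1) (k : ℕ) : P.coreT Φ k ⊆ (P.stepAR Φ (k + 1)).L.X 0 :=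
  P.coreT_subset_X_zero_succ Φ hsg k

/-- The true target lies in the enlarged target. [folklore] -/
theorem coreT_subset_coreER [DecidableEq V] (k : ℕ) : P.coreT Φ k ⊆ (P.stepAR Φ k).T := Finset.subset_union_left

/-- The excess part of the enlarged target is inside the rim part. [folklore] -/
theorem coreER_sdiff_subset [DecidableEq V] (k : ℕ) : (P.stepAR Φ k).T \ P.coreT Φ k ⊆ P.Rim k := P.coreE_sdiff_subset Φ k

/-- The sources agree. [folklore] -/
theorem stepAR_o [DecidableEq V] (k : ℕ) : (P.stepAR Φ k).L.o = P.root := rfl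

/-- The targets. [folklore] -/
theorem stepAR_T [DecidableEq V] (k : ℕ) : (P.stepAR Φ k).T = P.coreE Φ k := rfl

/-- The regions. [folklore] -/
theorem stepAR_D [DecidableEq V] (k : ℕ) : (P.stepAR Φ k).D = P.stepDR Φ k := rfl

variable {P}
variable (hsg : P.sg = 1 ∨ P.sg = -1) (hOK : Adv.AdvOK P.q P.q' P.s₁ P.ρ P.R' P.ℓ₀ P.nA)
include hsg hOK

/-- **`X^{(k)}_{Rlev+1} ⊆ DR_k`** when `Rlev + 1 ≤ R'` (`k ≤ nA`). [cite: KozmaNitzan2024, §4 Lemma 10 (p. 17: B⟨R+1⟩ ⊆ D)] -/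
theorem enclR (hRl : P.Rlev + 1 ≤ P.R') {k : ℕ} (hk : k ≤ P.nA) : (P.stepL Φ k).X (P.Rlev + 1) ⊆ P.stepDR Φ k := by
  rw [P.stepL_X Φ hsg, stepDR]
  refine Φ.Win_mono ((sBox_mono hsg _ ?_ ?_ ?_).trans (Adv.enlarge_core_subset_regionR hsg P.c hOK hk)) le_rfl <;> push_cast <;> omega

/-- **`T'_k ⊆ DR_k`** (`k ≤ nA`). [folklore] -/
theorem coreT_subset_stepDR {k : ℕ} (hk : k ≤ P.nA) : P.coreT Φ k ⊆ P.stepDR Φ k :=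
  Φ.Win_mono (Adv.core_succ_subset_regionR hsg P.c hOK hk) le_rfl

/-- **`T_k ⊆ DR_k`** when the rim part lies in the rooted region. [folklore] -/
theorem coreER_subset_stepDR [DecidableEq V] (hRim : ∀ k, P.Rim k ⊆ P.stepDR Φ k) {k : ℕ} (hk : k ≤ P.nA) : P.coreE Φ k ⊆ P.stepDR Φ k :=
  Finset.union_subset (coreT_subset_stepDR Φ hsg hOK hk) (hRim k)

/-- **`DR_k` lies in the prism window** `Win root {-(3q + s₁ + 2R') ≤ level ≤ q + (nA+1)s₁, |trans| ≤ ρ} Rπ`. [cite: KozmaNitzan2024, §4 Lemma 11 (p. 22: Ω)] -/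
theorem stepDR_subset_prism {k : ℕ} (hk : k ≤ P.nA) :
    P.stepDR Φ k ⊆ Φ.Win P.root (sBox P.ax P.sg P.c (-(Adv.ρ₀ P.q P.s₁ P.R')) (P.q + ((P.nA : ℤ) + 1) * P.s₁) P.ρ) P.Rπ :=
  Φ.Win_mono (Adv.regionR_subset_prism hsg P.c hOK hk) le_rfl

/-- **`KitsAt` of the rooted step `k`** (`k ≤ nA`; nonempty true target as a hypothesis). [cite: KozmaNitzan2024, §4 Lemma 10 (p. 17)] -/
theorem kitsAt_stepAR [DecidableEq V] (hRl : P.Rlev + 1 ≤ P.R') (hRim : ∀ k, P.Rim k ⊆ P.stepDR Φ k) {k : ℕ} (hk : k ≤ P.nA)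
    (hTne : (P.coreT Φ k).Nonempty) {Wt : Sym2 V → unitInterval} {p : unitInterval} {Δ : ℕ} {δ : ℝ}
    (hsub : KNLevels.IsSubbox (winGraph G P.root P.Rπ) Wt p (P.stepDR Φ k)) (hfin : FinSupp Wt P.Sfin) (hDS : P.stepDR Φ k ⊆ P.Sfin)
    (ho : P.root ∉ P.stepDR Φ k) (hoS : P.root ∈ P.Sfin) (hj : P.j₁ ≤ P.Rlev)
    (hcount : 1 / (1 - (p : ℝ)) ^ (Δ * P.N) ≤ δ * ((Finset.Icc P.j₀ P.j₁).card : ℝ))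
    (hkits : ∀ j ∈ Finset.Icc P.j₀ P.j₁, ∃ (σ : SData V) (S : Finset V),
      SHyp (winLData Φ P.root P.Rπ (P.alo k) (P.ahi k) P.root P.Sfin) j σ ∧ σ.N ≤ P.N ∧
      (1 - (p : ℝ) ^ σ.sB) ^ σ.k ≤ δ ∧ S ⊆ (winLData Φ P.root P.Rπ (P.alo k) (P.ahi k) P.root P.Sfin).X j ∧ S ⊆ P.stepDR Φ k ∧
      (∀ x ∈ σ.K, ∀ e ∈ σ.seed x, e ∉ wireSet (↑S : Set V)) ∧ (∀ x ∈ σ.K, σ.face x ⊆ S) ∧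
      (∀ x ∈ σ.K, 1 - 3 * δ ≤ (prodBernoulli Wt).real {ω | ∃ u ∈ σ.face x,
        1 - δ < (prodBernoulli (pinW Wt (wireSet (↑S : Set V)) ω)).real
          (⋃ t ∈ P.coreE Φ k, openConnIn (↑(P.stepDR Φ k) : Set V) u t)})) :
    (P.stepAR Φ k).KitsAt Wt p Δ δ := by
  have hL := lhyp_win Φ P.root P.Rπ (P.alo k) (P.ahi k) (Wt := Wt) (p := p) (D := P.stepDR Φ k) (Rl := P.Rlev) (o := P.root)
    (Sfin := P.Sfin) (by convert hsub) hfin hDS (enclR Φ hsg hOK hRl hk) ho hoS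
  refine ⟨?_, hj, coreER_subset_stepDR Φ hsg hOK hRim hk, hTne.mono (P.coreT_subset_coreER Φ k), hcount, hkits⟩
  convert hL using 1 <;> rfl

omit hsg hOK Φ in
/-- **THE PLANAR ROOM OF THE ROOTED RUN** (p3-g2's `hroom`, planar and unchanged): for `k ≤ nA`, every level `j ≤ j₁` (`j₁ ≤ Rlev`,
`Rlev + 1 ≤ R'`) and every `v ∈ Icc (alo k - j) (ahi k + j)` there is `ℓ ∈ [ℓ₀, ℓ₁]` (any `ℓ₁ ≥ 2q + s₁ + R'`) with `(box 2 ℓ).image (· + v) ⊆ aregionR k`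
and a quarter-face inside `acore (k + 1)`. [cite: KozmaNitzan2024, §4 Lemma 11 (pp. 22–23)] -/
theorem roomR (P : WinAdvData V) (hsg : P.sg = 1 ∨ P.sg = -1) (hOK : Adv.AdvOK P.q P.q' P.s₁ P.ρ P.R' P.ℓ₀ P.nA)
    (hRl : P.Rlev + 1 ≤ P.R') (hj : P.j₁ ≤ P.Rlev) {ℓ₁ : ℕ} (hℓ₁ : 2 * P.q + P.s₁ + P.R' ≤ ℓ₁) {k : ℕ} (hk : k ≤ P.nA) :
    ∀ j, j ≤ P.j₁ → ∀ v ∈ Finset.Icc (P.alo k - ((j : ℕ) : Site 2)) (P.ahi k + ((j : ℕ) : Site 2)), ∃ ℓ, P.ℓ₀ ≤ ℓ ∧ ℓ ≤ ℓ₁ ∧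
      (box 2 ℓ).image (fun t => t + v) ⊆ P.aregionR k ∧
      ∃ (a : Fin 2) (τ' : Fin 2 → ℤˣ), (orthantFace a τ' ℓ).image (fun t => t + v) ⊆ P.acore (k + 1) := by
  intro j hjj v hv
  rw [alo, ahi, sBox_enlarge _ _ hsg] at hv
  have hjR : (j : ℤ) ≤ P.R' := by exact_mod_cast (hjj.trans hj).trans (by omega : P.Rlev ≤ P.R')
  have hv' : v ∈ sBox P.ax P.sg P.c (Adv.coreα P.q P.s₁ k - P.R') (Adv.coreβ P.q P.s₁ k + P.R') (Adv.coreW P.q P.q' P.s₁ P.R' k + P.R') :=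
    sBox_mono hsg _ (by linarith) (by linarith) (by linarith) hv
  obtain ⟨ℓ, hℓ0, hℓ1, hsq, τ, hface⟩ := Adv.core_routeR_le hsg P.c hOK hk hv'
  have hℓ1' : ℓ ≤ ℓ₁ := by
    have : (ℓ : ℤ) ≤ ℓ₁ := hℓ1.trans hℓ₁
    exact_mod_cast this
  exact ⟨ℓ, hℓ0, hℓ1', hsq, P.ax, τ, hface⟩

/-- **THE ROOTED STRAIGHT RUN TRANSFERRED** (the elongated deep route of a face-step contact from its wired cube, Step IV's `h3`): the chain of
`nA + 1` rooted steps in the window graph `winGraph G P.root P.Rπ` under a weighting `W'` with per-step facts, nonempty true targets, rim excess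
`≤ η ≤ δ/2`, a chain property of length `nA + 1` at `(δ ↦ ε'')`, a source bound towards `B₀ ⊆ X^{(0)}_0`, the far face inside `Ft` and
`P_{W'}(⋃ t ∈ Ft, root ↔ t) ≤ μA` give `1 - ε'' < μA`. [cite: KozmaNitzan2024, §4 Lemma 11 (pp. 22–23), Lemma 12 (pp. 23–25), p. 20 (Step IV)] -/
theorem lt_real_of_advRChain [DecidableEq V] (hRl : P.Rlev + 1 ≤ P.R') (hRim : ∀ k, P.Rim k ⊆ P.stepDR Φ k)
    (hTne : ∀ k ≤ P.nA, (P.coreT Φ k).Nonempty)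
    {p : unitInterval} {W' : Sym2 V → unitInterval} {Ft B₀ : Finset V} {μA : ℝ} {Δ' : ℕ} {δ ε'' η : ℝ}
    (hchain : ∀ (Wg : Sym2 V → unitInterval) (s : Fin (P.nA + 1) → TStep (winGraph G P.root P.Rπ))
      (T' : Fin (P.nA + 1) → Finset V) (η : ℝ),
      (∀ i, (s i).L.o = (s 0).L.o) →
      (∀ i : Fin P.nA, T' (Fin.castSucc i) ⊆ (s i.succ).L.X 0) →
      (∀ i, T' i ⊆ (s i).T) →
      (∀ i, (s i).KitsAt Wg p Δ' δ) →
      η ≤ δ / 2 →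
      (∀ i, (prodBernoulli Wg).real (⋃ t ∈ (s i).T \ T' i, openConn (s 0).L.o t) ≤ η) →
      1 - δ < (prodBernoulli Wg).real (s 0).L.reachB →
        1 - ε'' < (prodBernoulli Wg).real (⋃ t ∈ T' (Fin.last P.nA), openConn (s 0).L.o t))
    (hsub : ∀ k ≤ P.nA, IsSubbox (winGraph G P.root P.Rπ) W' p (P.stepDR Φ k)) (hfin : FinSupp W' P.Sfin)
    (hDS : ∀ k ≤ P.nA, P.stepDR Φ k ⊆ P.Sfin) (ho : ∀ k ≤ P.nA, P.root ∉ P.stepDR Φ k) (hoS : P.root ∈ P.Sfin) (hj : P.j₁ ≤ P.Rlev)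
    (hcount : 1 / (1 - (p : ℝ)) ^ (Δ' * P.N) ≤ δ * ((Finset.Icc P.j₀ P.j₁).card : ℝ))
    (hkits : ∀ k ≤ P.nA, ∀ j ∈ Finset.Icc P.j₀ P.j₁, ∃ (σ : SData V) (Sz : Finset V),
      SHyp (winLData Φ P.root P.Rπ (P.alo k) (P.ahi k) P.root P.Sfin) j σ ∧ σ.N ≤ P.N ∧
      (1 - (p : ℝ) ^ σ.sB) ^ σ.k ≤ δ ∧ Sz ⊆ (winLData Φ P.root P.Rπ (P.alo k) (P.ahi k) P.root P.Sfin).X j ∧ Sz ⊆ P.stepDR Φ k ∧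
      (∀ x ∈ σ.K, ∀ e ∈ σ.seed x, e ∉ wireSet (↑Sz : Set V)) ∧ (∀ x ∈ σ.K, σ.face x ⊆ Sz) ∧
      (∀ x ∈ σ.K, 1 - 3 * δ ≤ (prodBernoulli W').real {ω | ∃ u ∈ σ.face x,
        1 - δ < (prodBernoulli (pinW W' (wireSet (↑Sz : Set V)) ω)).real
          (⋃ t ∈ P.coreE Φ k, openConnIn (↑(P.stepDR Φ k) : Set V) u t)}))
    (hη : η ≤ δ / 2) (hexc : ∀ k ≤ P.nA, (prodBernoulli W').real (⋃ t ∈ P.Rim k, openConn P.root t) ≤ η)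
    (hB₀ : B₀ ⊆ (P.stepL Φ 0).X 0) (hsrc : 1 - δ < (prodBernoulli W').real (⋃ t ∈ B₀, openConn P.root t))
    (hTn : P.coreT Φ P.nA ⊆ Ft) (hdom : (prodBernoulli W').real (⋃ t ∈ Ft, openConn P.root t) ≤ μA) :
    1 - ε'' < μA := by
  let s : Fin (P.nA + 1) → TStep (winGraph G P.root P.Rπ) := fun i => P.stepAR Φ i
  let T' : Fin (P.nA + 1) → Finset V := fun i => P.coreT Φ i
  have hle : ∀ i : Fin (P.nA + 1), (i : ℕ) ≤ P.nA := fun i => Nat.lt_succ_iff.1 i.2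
  refine lt_real_of_chain (winGraph G P.root P.Rπ) hchain s T' (fun i => P.stepAR_o Φ i) (fun i => ?_) (fun i => P.coreT_subset_coreER Φ i)
    (fun i => ?_) hη (fun i => ?_) ?_ ?_ hdom
  · -- the true targets link the chain
    show P.coreT Φ (Fin.castSucc i) ⊆ (P.stepAR Φ i.succ).L.X 0
    have : ((i.succ : Fin (P.nA + 1)) : ℕ) = (Fin.castSucc i : ℕ) + 1 := by simp
    rw [show P.stepAR Φ (i.succ : ℕ) = P.stepAR Φ ((Fin.castSucc i : ℕ) + 1) by rw [this]]
    exact P.coreT_subset_XR_zero_succ Φ hsg _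
  · exact kitsAt_stepAR Φ hsg hOK hRl hRim (hle i) (hTne i (hle i)) (hsub i (hle i)) hfin (hDS i (hle i)) (ho i (hle i)) hoS hj hcount
      (hkits i (hle i))
  · -- the excess of the enlarged target is inside the rim part
    refine le_trans (measureReal_mono ?_ (measure_ne_top _ _)) (hexc i (hle i))
    intro ω hω
    simp only [Set.mem_iUnion, exists_prop] at hω ⊢
    obtain ⟨t, ht, hωt⟩ := hω
    exact ⟨t, P.coreER_sdiff_subset Φ i ht, hωt⟩
  · -- the source bound: `B₀ ⊆ X^{(0)}_0`
    show 1 - δ < (prodBernoulli W').real (P.stepAR Φ ((0 : Fin (P.nA + 1)) : ℕ)).L.reachB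
    rw [Fin.val_zero]
    refine hsrc.trans_le (measureReal_mono ?_ (measure_ne_top _ _))
    intro ω hω
    simp only [Set.mem_iUnion, exists_prop] at hω
    obtain ⟨t, ht, hωt⟩ := hω
    show ω ∈ (P.stepL Φ 0).reachB
    exact Set.mem_biUnion (Finset.mem_coe.2 (hB₀ ht)) hωt
  · -- the far face lies in `Ft`
    show P.coreT Φ ((Fin.last P.nA : Fin (P.nA + 1)) : ℕ) ⊆ Ft
    rw [Fin.val_last]; exact hTn

end WinAdvData

end Skel

end Transplant

end Summit.CriticalPhenomena.PercolationContinuityZ3.Theorems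

end
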